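import Mathlib
import HarnessLib

/-!
# The suspension `Σ(x₀^(m+1)) ⊆ 𝔸^(n+3)` is the affine `n`-space over the surface `A_m`

Support file for crux stmt-ResolutionOfSingularities-15317 (`FrobeniusLadder.FRationalResolution`),
line `Sketch`, theme B (transport of rung 4′ along affine spaces). In the c2 suspension convention
(`y = X (inl 0)`, `z = X (inl 1)`, `xᵢ = X (inr i)` in `MvPolynomial (Fin 2 ⊕ Fin r) k`) the
hypersurface `yz + x₀^(m+1) = 0` of `𝔸^(n+3) = Spec k[y,z,x₀,…,xₙ]` only involves the variables
`y, z, x₀`, so it is the product of `𝔸ⁿ` with the surface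
`A_m = Spec k[y,z,x]/(yz + x^(m+1))`:

* `nonempty_ringEquiv_suspensionPow_mvPolynomial` — the ring isomorphism
  `A_m[t₁,…,tₙ] ≃+* k[y,z,x₀,…,xₙ]/(yz + x₀^(m+1))` (through
  `MvPolynomial.quotientEquivQuotientMvPolynomial`, `MvPolynomial.sumAlgEquiv`,
  `MvPolynomial.renameEquiv`, `Ideal.quotientEquiv`);
* `stub_suspensionPow_affineSpace_iso` — **the scheme isomorphism
  `Spec k[y,z,x₀,…,xₙ]/(yz + x₀^(m+1)) ≅ 𝔸(Fin n; A_m)`** (`AffineSpace.SpecIso`).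

References: Hartshorne II.3 (fibre products of affine schemes), Stacks 01JN.
-/

-- single-problem summit: the doubled namespace component `ResolutionOfSingularities` is forced
set_option linter.dupNamespace false

noncomputable section

open CategoryTheory AlgebraicGeometry TopologicalSpace

namespace Summit.ResolutionOfSingularities.ResolutionOfSingularities.Theorems.FRationalResolution

section SuspensionPowAffineSpace

open MvPolynomial

/-- The polynomial ring in `n` variables over `A_m = k[y,z,x]/(yz + x^(m+1))` is
`k[y,z,x₀,…,xₙ]/(yz + x₀^(m+1))` (c2 suspension convention: `y = X (inl 0)`, `z = X (inl 1)`,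
`xᵢ = X (inr i)`). -/
theorem nonempty_ringEquiv_suspensionPow_mvPolynomial (k : Type) [Field k] (n m : ℕ) :
    Nonempty (MvPolynomial (Fin n) (MvPolynomial (Fin 2 ⊕ Fin 1) k ⧸ Ideal.span
        {(MvPolynomial.X (Sum.inl 0) * MvPolynomial.X (Sum.inl 1) +
          MvPolynomial.rename Sum.inr (MvPolynomial.X 0 ^ (m + 1)) :
            MvPolynomial (Fin 2 ⊕ Fin 1) k)}) ≃+*
      MvPolynomial (Fin 2 ⊕ Fin (n + 1)) k ⧸ Ideal.span
        {(MvPolynomial.X (Sum.inl 0) * MvPolynomial.X (Sum.inl 1) +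
          MvPolynomial.rename Sum.inr (MvPolynomial.X 0 ^ (m + 1)) :
            MvPolynomial (Fin 2 ⊕ Fin (n + 1)) k)}) := by
  -- the reindexing `Fin n ⊕ (Fin 2 ⊕ Fin 1) ≃ Fin 2 ⊕ Fin (n + 1)`:
  -- `inr (inl i) ↦ inl i`, `inr (inr 0) ↦ inr 0`, `inl j ↦ inr (1 + j)`
  let ε : Fin n ⊕ (Fin 2 ⊕ Fin 1) ≃ Fin 2 ⊕ Fin (n + 1) :=
    (Equiv.sumComm _ _).trans ((Equiv.sumAssoc _ _ _).trans
      (Equiv.sumCongr (Equiv.refl _) (finSumFinEquiv.trans (finCongr (Nat.add_comm 1 n)))))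
  have hε0 : ε (Sum.inr (Sum.inl 0)) = Sum.inl 0 := rfl
  have hε1 : ε (Sum.inr (Sum.inl 1)) = Sum.inl 1 := rfl
  have hε2 : ε (Sum.inr (Sum.inr 0)) = Sum.inr 0 := rfl
  -- the `k`-algebra isomorphism `k[y,z,x][t₁..tₙ] ≃ k[y,z,x₀,…,xₙ]`
  let Φ : MvPolynomial (Fin n) (MvPolynomial (Fin 2 ⊕ Fin 1) k) ≃+*
      MvPolynomial (Fin 2 ⊕ Fin (n + 1)) k :=
    (sumAlgEquiv k (Fin n) (Fin 2 ⊕ Fin 1)).symm.toRingEquiv.trans (renameEquiv k ε).toRingEquiv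
  have hsum : ∀ p : MvPolynomial (Fin 2 ⊕ Fin 1) k,
      (sumAlgEquiv k (Fin n) (Fin 2 ⊕ Fin 1)).symm (C p) = rename Sum.inr p := by
    intro p
    have h := DFunLike.congr_fun
      (sumAlgEquiv_comp_rename_inr (R := k) (S₁ := Fin n) (S₂ := Fin 2 ⊕ Fin 1)) p
    simp only [AlgHom.comp_apply, IsScalarTower.toAlgHom_apply, MvPolynomial.algebraMap_eq] at h
    rw [← h]
    exact (sumAlgEquiv k (Fin n) (Fin 2 ⊕ Fin 1)).symm_apply_apply _
  have hΦ : Φ (C (X (Sum.inl 0) * X (Sum.inl 1) + rename Sum.inr (X 0 ^ (m + 1)) :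
      MvPolynomial (Fin 2 ⊕ Fin 1) k)) =
      (X (Sum.inl 0) * X (Sum.inl 1) + rename Sum.inr (X 0 ^ (m + 1)) :
        MvPolynomial (Fin 2 ⊕ Fin (n + 1)) k) := by
    change rename ε ((sumAlgEquiv k (Fin n) (Fin 2 ⊕ Fin 1)).symm (C _)) = _
    rw [hsum, rename_rename]
    simp only [map_add, map_mul, map_pow, rename_X, Function.comp_apply, hε0, hε1, hε2]
  refine ⟨(quotientEquivQuotientMvPolynomial (Ideal.span {_})).toRingEquiv.trans
    (Ideal.quotientEquiv _ _ Φ ?_)⟩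
  rw [Ideal.map_map, Ideal.map_span, Set.image_singleton, RingHom.comp_apply,
    RingEquiv.coe_toRingHom, hΦ]

/-- **Theme B, the product structure.** The hypersurface `yz + x₀^(m+1) = 0` in
`𝔸^(n+3) = Spec k[y,z,x₀,…,xₙ]` is the affine `n`-space over the surface
`A_m = Spec k[y,z,x]/(yz + x^(m+1))`. -/
theorem stub_suspensionPow_affineSpace_iso (k : Type) [Field k] (n m : ℕ) :
    Nonempty (Spec (CommRingCat.of (MvPolynomial (Fin 2 ⊕ Fin (n + 1)) k ⧸ Ideal.span
        {(MvPolynomial.X (Sum.inl 0) * MvPolynomial.X (Sum.inl 1) +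
          MvPolynomial.rename Sum.inr (MvPolynomial.X 0 ^ (m + 1)) :
            MvPolynomial (Fin 2 ⊕ Fin (n + 1)) k)})) ≅
      AffineSpace (Fin n) (Spec (CommRingCat.of (MvPolynomial (Fin 2 ⊕ Fin 1) k ⧸ Ideal.span
        {(MvPolynomial.X (Sum.inl 0) * MvPolynomial.X (Sum.inl 1) +
          MvPolynomial.rename Sum.inr (MvPolynomial.X 0 ^ (m + 1)) :
            MvPolynomial (Fin 2 ⊕ Fin 1) k)})))) := by
  obtain ⟨e⟩ := nonempty_ringEquiv_suspensionPow_mvPolynomial k n m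
  exact ⟨Scheme.Spec.mapIso e.toCommRingCatIso.op ≪≫ (AffineSpace.SpecIso (Fin n) _).symm⟩

end SuspensionPowAffineSpace

end Summit.ResolutionOfSingularities.ResolutionOfSingularities.Theorems.FRationalResolution

end
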